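import Literature.Geometry.Lorentzian.SpacetimeLocalConvergence
import HarnessLib

/-!
# Time reversal of a spacetime

The time-reversed spacetime `𝓢.reverse = (M, g, −T)` (`TimeOrientation.reverse`): same carrier and
metric, future and past exchanged (O'Neill 1983, Ch. 5, p. 145). Chart-level bookkeeping: metric
components, deviations and late charts do not see the orientation; for a chart map `Ψ : ↥O → 𝓢`,
`dΨ(−∂₀)` is future-directed iff `dΨ(∂₀)` is past-directed, and `dΨ(∂₀)` is future-directed in
`𝓢.reverse` iff `dΨ(−∂₀)` is future-directed in `𝓢`. Used to produce pointed limits of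
sequences of charts pushing `∂₀` to the past (`TameChartCompactnessUnoriented.lean`).

## References
* B. O'Neill, *Semi-Riemannian geometry*, Academic Press 1983, Ch. 5, p. 145. [ONeill1983]
-/

noncomputable section

open Set Filter TopologicalSpace Function
open scoped Manifold ContDiff Topology

universe u

namespace Literature.Geometry.Lorentzian

namespace Spacetime

/-- **The time-reversed spacetime** `(M, g, −T)`. [cite: ONeill1983, Ch. 5, p. 145] -/
def reverse (𝓢 : Spacetime.{u} 4) : Spacetime.{u} 4 :=
  { 𝓢 with timeOrientation := 𝓢.timeOrientation.reverse }

variable (𝓢 : Spacetime.{u} 4)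

/-- The carrier of the reversed spacetime. [folklore] -/
theorem reverse_carrier : 𝓢.reverse.carrier = 𝓢.carrier := rfl

/-- The metric of the reversed spacetime. [folklore] -/
theorem reverse_metric : 𝓢.reverse.metric = 𝓢.metric := rfl

/-- The time orientation of the reversed spacetime. [folklore] -/
theorem reverse_timeOrientation : 𝓢.reverse.timeOrientation = 𝓢.timeOrientation.reverse := rfl

/-- The orienting field of the reversed spacetime is `−T`. [folklore] -/
@[simp]
theorem reverse_vectorField (x : 𝓢.carrier) :
    𝓢.reverse.timeOrientation.vectorField x = -𝓢.timeOrientation.vectorField x := rfl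

/-- Metric components do not see the orientation. [folklore] -/
theorem reverse_metricInCoords (ψ : E4 → 𝓢.carrier) :
    𝓢.reverse.metricInCoords ψ = 𝓢.metricInCoords ψ := rfl

/-- Deviations from a background do not see the orientation. [folklore] -/
theorem reverse_deviationExtend (B : ModelBackground) (Ψ : B.domain → 𝓢.carrier) :
    𝓢.reverse.deviationExtend B Ψ = 𝓢.deviationExtend B Ψ := rfl

/-- Late charts do not see the orientation. [folklore] -/
theorem reverse_isLateChart_iff (B : ModelBackground) (𝒟 : Set 𝓢.carrier) (τ₀ : ℝ)
    (Ψ : B.domain → 𝓢.carrier) :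
    𝓢.reverse.IsLateChart B 𝒟 τ₀ Ψ ↔ 𝓢.IsLateChart B 𝒟 τ₀ Ψ :=
  ⟨fun h ↦ ⟨h.contMDiff, h.isOpenEmbedding, h.image_subset⟩,
    fun h ↦ ⟨h.contMDiff, h.isOpenEmbedding, h.image_subset⟩⟩

/-- Reversing twice gives back the original orientation, pointwise. [folklore] -/
theorem reverse_reverse_vectorField (x : 𝓢.carrier) :
    𝓢.reverse.reverse.timeOrientation.vectorField x = 𝓢.timeOrientation.vectorField x :=
  neg_neg (𝓢.timeOrientation.vectorField x : E4)

/-- `dΨ(−∂₀)` is future-directed iff `dΨ(∂₀)` is past-directed. [cite: ONeill1983, Ch. 5, p. 145] -/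
theorem isFutureDirected_mfderiv_neg_basisVector_iff {O : Opens E4} (Ψ : O → 𝓢.carrier) (z : O) :
    𝓢.timeOrientation.IsFutureDirected (mfderiv 𝓘(ℝ, E4) (𝓡 4) Ψ z (-(E4.basisVector 0 : E4))) ↔
      𝓢.timeOrientation.IsPastDirected (mfderiv 𝓘(ℝ, E4) (𝓡 4) Ψ z (E4.basisVector 0)) := by
  rw [← TimeOrientation.isFutureDirected_neg_iff]
  exact Iff.of_eq (congrArg _ (ContinuousLinearMap.map_neg _ _))

/-- For the REVERSED spacetime, `dΨ(∂₀)` is future-directed iff `dΨ(−∂₀)` is future-directed in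
the original one. [cite: ONeill1983, Ch. 5, p. 145] -/
theorem isFutureDirected_reverse_mfderiv_basisVector_iff {O : Opens E4} (Ψ : O → 𝓢.carrier) (z : O) :
    𝓢.reverse.timeOrientation.IsFutureDirected (mfderiv 𝓘(ℝ, E4) (𝓡 4) Ψ z (E4.basisVector 0)) ↔
      𝓢.timeOrientation.IsFutureDirected
        (mfderiv 𝓘(ℝ, E4) (𝓡 4) Ψ z (-(E4.basisVector 0 : E4))) := by
  rw [𝓢.isFutureDirected_mfderiv_neg_basisVector_iff Ψ z]
  exact 𝓢.timeOrientation.isFutureDirected_reverse_iff _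

/-- A timelike image `dΨ(∂₀)` is future-directed in `𝓢` or in `𝓢.reverse`. [cite: ONeill1983, Ch. 5, Lemma 5.26 ff.] -/
theorem isFutureDirected_or_reverse_of_isCausal {O : Opens E4} (Ψ : O → 𝓢.carrier) (z : O)
    (h : 𝓢.metric.IsCausal (mfderiv 𝓘(ℝ, E4) (𝓡 4) Ψ z (E4.basisVector 0))) :
    𝓢.timeOrientation.IsFutureDirected (mfderiv 𝓘(ℝ, E4) (𝓡 4) Ψ z (E4.basisVector 0)) ∨
      𝓢.reverse.timeOrientation.IsFutureDirected (mfderiv 𝓘(ℝ, E4) (𝓡 4) Ψ z (E4.basisVector 0)) := by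
  rcases 𝓢.timeOrientation.isFutureDirected_or_isPastDirected_of_isCausal h with h' | h'
  · exact Or.inl h'
  · exact Or.inr ((𝓢.timeOrientation.isFutureDirected_reverse_iff _).2 h')

end Spacetime

end Literature.Geometry.Lorentzian

end
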